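/-
Copyright (c) 2026 the pub-hodgecm-mathlib formalisation cell (harness21).  Prover seat hodgecm-mathlib-LH4-p12 (g4), Track A «(D-RAM) FOUR-FRAME», unit U2H, the census leaf
(ρ2b′-X) `stub_U2H_fixedPointCensus_typeTwo_unit0` — RHO2BX-ORDER v1 (LH4-p14 (g3)) organ O-W, part T3-T «the elliptic plane as a field line», file 2: THE COUNT TRANSPORT.  2026-09-04.
-/
import Literature.NumberTheory.Automorphic.EllipticPlaneAsFieldLineDictionary   -- ★ file 1 (same seat): (D1)–(D4) images of lattices, `γ`∕`lam`-stability, duals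
import HarnessLib

/-!
# The elliptic plane as a field line, II: the `γ₂`-fixed self-dual lattices of a plane `(E², H₂)` are equinumerous with the `λ`-stable hermitian-self-dual ORDER
# LATTICES `z·(𝒪_E + c𝒪_M)` of its line model `(M, Tr(hΘ(a)b), ×λ)` (Kottwitz 1986 §1; Bruhat–Tits 1972 §10; Flicker 1998 p. 84 (Mars); Jacobowitz 1962 §4)

Topic `NumberTheory/Automorphic`; namespace `Literature.NumberTheory.Automorphic.EllipticPlaneAsFieldLine` (= ★ file 1).  THEOREMS ONLY (no definition, no instance, no notation, no
named fact, no `sorry`); kernel lane `--supports stmt-HodgeConjecture-24833` (count-neutral).  Cell `pub/hodgecm-mathlib` (D-0151), crux H413, Track A «(D-RAM) FOUR-FRAME», unit U2H: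
RHO2BX-ORDER v1 (payer LH4-p14 (g3)) organ **O-W**, part T3-T head (C) of `F0/P3c/LH4/LH4-p12/g4/t3/EllipticPlaneAsFieldLine.HEAD.v1` e3028a10.  The W-side set of ★
`UnitaryLatticeTree.ncard_selfDual_fixed_axis_eq` (the AXIS TERM of the type-(2) block census: `{B ⊂ E² | B self-dual for H₂, γ₂·B = B}`) is carried by `B ↦ φ(B)` onto the set of
additive subgroups `Λ ≤ M` of the LINE MODEL which are ORDER LATTICES `z·(𝒪^ρ + c𝒪)` (★ Mars 2-free), `lam`-STABLE, and EQUAL TO THEIR HERMITIAN DUAL for `Tr(h·Θ(a)·b)` —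
the currency in which ★ T4 (`QuadraticOrderLattices` ∕ `…HermitianDual`: `z·𝒪_j`, `lam ∈ 𝒪_j`, `y = h·zΘz·c(α − ρα) ∈ 𝒪_jˣ`) evaluates it (`Theorems/F0P3cDyRamWSideOrderCensus`).

FRAME: as file 1 (explicit binders: `σ` isometric on `E`, `0 < |ϖ| ≤ 1`, `H₂` non-degenerate; `jE : E →+* M` with range `Fix ρ` and `|jE c| ≤ 1 ↔ |c| ≤ 1`; `ρ`, `α`, `hint`
of ★ T4; the model `φ` additive, `E`-semilinear, bijective, `φ(γ₂ x) = lam·φ x` with `|lam| = 1`, `jE⟨x,y⟩ = hΘ(φx)φy + ρ(hΘ(φx)φy)`).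

* (C) **`ncard_selfDual_fixed_eq_ncard_orderLatt`** — the count transport, by `Set.ncard_congr` on `B ↦ B.toAddSubgroup.map φ`: into (★ (D1), (D3), (D4) + ★
  `dualLatt_eq_self_of_isSelfDualLattice`), injective (`φ` injective), onto (★ (D2), (D3), (D4) + ★ `isSelfDualLattice_latt_of_dualLatt_eq`).
HONEST LABEL: HC_CM is proved only modulo the 7 printed citations (2 remaining named inputs: hLiu418 = stmt-HodgeConjecture-24832, h413 = stmt-HodgeConjecture-24833) until rung 0
closes; unconditional lattice algebra, count-neutral (the EXISTENCE of the line model at a CM place — organ T3-E — and the evaluation of the right-hand side are separate files).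

## References
* [Kottwitz1986BaseChangeUnits] R. E. Kottwitz, *Base change for unit elements of Hecke algebras*, Compositio Math. 60 (1986), §1 pp. 240–241 (orbital integrals of units as
  fixed-lattice counts).
* [BruhatTits1972] F. Bruhat, J. Tits, *Groupes réductifs sur un corps local I*, Publ. Math. IHÉS 41 (1972), §10 (lattice models of rank-one groups).
* [Flicker1998UnitaryFL] Y. Z. Flicker, *Elementary proof of the fundamental lemma for a unitary group*, Canad. J. Math. 50 (1998), p. 84 REMARK (Mars: lattices of `E` are `z·R_E(j)`;
  `H = ⊔_j T_H r_j K_H`).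
* [Jacobowitz1962] R. Jacobowitz, *Hermitian forms over local fields*, Amer. J. Math. 84 (1962): §4 (hermitian lattices, duals, unimodular lattices).
-/

set_option autoImplicit false

noncomputable section

open scoped Valued WithZero Matrix MatrixGroups
open WithZero
open Literature.NumberTheory.Automorphic Literature.NumberTheory.Automorphic.HermitianLattice Literature.NumberTheory.Automorphic.UnitaryLatticeTree
open Literature.NumberTheory.LocalFields.QuadraticOrder

namespace Literature.NumberTheory.Automorphic.EllipticPlaneAsFieldLine

variable {E M : Type*} [Field E] [Valued E ℤᵐ⁰] [Field M] [Valued M ℤᵐ⁰]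

omit [Valued M ℤᵐ⁰] in
/-- Images under an injective additive map separate `𝒪_E`-submodules. [cite: BruhatTits1972, §10] -/
theorem map_toAddSubgroup_injective (φ : (Fin 2 → E) →+ M) (hφi : Function.Injective φ)
    {B B' : Submodule 𝒪[E] (Fin 2 → E)} (h : B.toAddSubgroup.map φ = B'.toAddSubgroup.map φ) : B = B' := by
  have h' : B.toAddSubgroup = B'.toAddSubgroup := AddSubgroup.map_injective hφi h
  exact Submodule.toAddSubgroup_injective h'

/-- For a SELF-DUAL `B` and a bijective model, `φ(B)` equals its hermitian dual: `(∀ a ∈ φB, |hΘ(a)m + ρ(hΘ(a)m)| ≤ 1) ⟺ m ∈ φB` (★ (D4) + `B^♯ = B`). [cite: Jacobowitz1962, §4] -/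
theorem forall_herm_iff_mem_of_dualLatt_eq (σ : E →+* E) (H₂ : Matrix (Fin 2) (Fin 2) E) (jE : E →+* M) (ρ Θ : M →+* M) (h : M)
    (hjv : ∀ c, Valued.v (jE c) ≤ 1 ↔ Valued.v c ≤ 1)
    (φ : (Fin 2 → E) →+ M) (hφi : Function.Injective φ) (hφo : Function.Surjective φ)
    (hform : ∀ x y, jE (pairing σ H₂ x y) = h * Θ (φ x) * φ y + ρ (h * Θ (φ x) * φ y))
    {B : Submodule 𝒪[E] (Fin 2 → E)} (hB : dualLatt σ H₂ B = B) (m : M) :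
    (∀ a ∈ B.toAddSubgroup.map φ, Valued.v (h * Θ a * m + ρ (h * Θ a * m)) ≤ 1) ↔ m ∈ B.toAddSubgroup.map φ := by
  obtain ⟨x, rfl⟩ := hφo m
  rw [← mem_dualLatt_iff_forall_v_herm_le_one σ H₂ jE ρ Θ h hjv φ hform B x, hB]
  constructor
  · intro hx; exact AddSubgroup.mem_map.2 ⟨x, hx, rfl⟩
  · intro hx
    obtain ⟨x', hx', hxx'⟩ := AddSubgroup.mem_map.1 hx
    rw [← hφi hxx']; exact hx'

/-- Conversely, if `φ(B)` equals its hermitian dual then `B^♯ = B`. [cite: Jacobowitz1962, §4] -/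
theorem dualLatt_eq_of_forall_herm_iff_mem (σ : E →+* E) (H₂ : Matrix (Fin 2) (Fin 2) E) (jE : E →+* M) (ρ Θ : M →+* M) (h : M)
    (hjv : ∀ c, Valued.v (jE c) ≤ 1 ↔ Valued.v c ≤ 1)
    (φ : (Fin 2 → E) →+ M) (hφi : Function.Injective φ)
    (hform : ∀ x y, jE (pairing σ H₂ x y) = h * Θ (φ x) * φ y + ρ (h * Θ (φ x) * φ y))
    {B : Submodule 𝒪[E] (Fin 2 → E)}
    (hB : ∀ m, (∀ a ∈ B.toAddSubgroup.map φ, Valued.v (h * Θ a * m + ρ (h * Θ a * m)) ≤ 1) ↔ m ∈ B.toAddSubgroup.map φ) :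
    dualLatt σ H₂ B = B := by
  ext x
  rw [mem_dualLatt_iff_forall_v_herm_le_one σ H₂ jE ρ Θ h hjv φ hform B x, hB (φ x)]
  constructor
  · intro hx
    obtain ⟨x', hx', hxx'⟩ := AddSubgroup.mem_map.1 hx
    rw [← hφi hxx']; exact hx'
  · intro hx; exact AddSubgroup.mem_map.2 ⟨x, hx, rfl⟩

/-- **(C) THE COUNT TRANSPORT.**  The `γ₂`-fixed SELF-DUAL `𝒪_E`-lattices of the plane `(E², H₂)` are equinumerous with the additive subgroups `Λ ≤ M` of the line model that are
ORDER LATTICES `z·(𝒪^ρ + c𝒪)` (spelled out), `lam`-STABLE (`lam·Λ ⊆ Λ`) and HERMITIAN-SELF-DUAL (`Λ = {m | ∀ a ∈ Λ, |hΘ(a)m + ρ(hΘ(a)m)| ≤ 1}`); the bijection is `B ↦ φ(B)`.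
This is the W-side set of ★ `ncard_selfDual_fixed_axis_eq` (labels `P₂ := ⊤`), read on `M`; ★ T4 then evaluates it (`z·𝒪_j`, `lam ∈ 𝒪_j`, `h·zΘz·c(α − ρα) ∈ 𝒪_jˣ`).
[cite: Kottwitz1986BaseChangeUnits, §1 pp. 240–241] [cite: BruhatTits1972, §10] [cite: Flicker1998UnitaryFL, p. 84 REMARK] [cite: Jacobowitz1962, §4] -/
theorem ncard_selfDual_fixed_eq_ncard_orderLatt (σ : E →+* E) (hvσ : ∀ a, Valued.v (σ a) = Valued.v a) {ϖ : E} (hϖ0 : ϖ ≠ 0) (hϖ1 : Valued.v ϖ ≤ 1)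
    {H₂ : Matrix (Fin 2) (Fin 2) E} (hH₂ : IsUnit H₂.det) (jE : E →+* M) {ρ Θ : M →+* M} {α : M}
    (hρρ : ∀ x, ρ (ρ x) = x) (hvρ : ∀ x, Valued.v (ρ x) = Valued.v x) (hα : ρ α ≠ α) (hα1 : Valued.v α ≤ 1)
    (hint : ∀ z : M, Valued.v z ≤ 1 → Valued.v ((z - ρ z) / (α - ρ α)) ≤ 1)
    (hjv : ∀ c, Valued.v (jE c) ≤ 1 ↔ Valued.v c ≤ 1) (hjfix : ∀ z, ρ z = z ↔ ∃ c, jE c = z)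
    (φ : (Fin 2 → E) →+ M) (hφs : ∀ (c : E) (x : Fin 2 → E), φ (c • x) = jE c * φ x) (hφi : Function.Injective φ) (hφo : Function.Surjective φ)
    {γ₂ : GL (Fin 2) E} {lam h : M} (hφγ : ∀ x, φ ((γ₂ : Matrix (Fin 2) (Fin 2) E).mulVec x) = lam * φ x) (hlam : Valued.v lam = 1)
    (hform : ∀ x y, jE (pairing σ H₂ x y) = h * Θ (φ x) * φ y + ρ (h * Θ (φ x) * φ y)) :
    {B : Submodule 𝒪[E] (Fin 2 → E) | IsSelfDualLattice σ ϖ H₂ B ∧ mapGL γ₂ B = B}.ncard =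
      {Λ : AddSubgroup M | (∃ z c : M, z ≠ 0 ∧ ρ c = c ∧ c ≠ 0 ∧ Valued.v c ≤ 1 ∧
          ∀ x, x ∈ Λ ↔ ∃ y, (Valued.v y ≤ 1 ∧ Valued.v (y - ρ y) ≤ Valued.v (c * (α - ρ α))) ∧ x = z * y) ∧
        (∀ x ∈ Λ, lam * x ∈ Λ) ∧ (∀ m, (∀ a ∈ Λ, Valued.v (h * Θ a * m + ρ (h * Θ a * m)) ≤ 1) ↔ m ∈ Λ)}.ncard := by
  classical
  refine Set.ncard_congr (fun B _ => B.toAddSubgroup.map φ) ?_ ?_ ?_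
  · -- into
    rintro B ⟨hSD, hfix⟩
    have hdual : dualLatt σ H₂ B = B := dualLatt_eq_self_of_isSelfDualLattice hvσ hH₂ hSD
    obtain ⟨g, hBg, -, -, -⟩ := hSD
    subst hBg
    refine ⟨?_, ?_, ?_⟩
    · exact exists_eq_mul_order_map_latt jE hρρ hα hα1 hint hjv hjfix φ hφs hφi g
    · exact (mapGL_eq_iff_forall_mul_mem jE hρρ hvρ hα hα1 hint hjv hjfix φ hφs hφi hφγ hlam g).1 hfix
    · exact forall_herm_iff_mem_of_dualLatt_eq σ H₂ jE ρ Θ h hjv φ hφi hφo hform hdual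
  · -- injective
    intro B B' _ _ hBB'
    exact map_toAddSubgroup_injective φ hφi hBB'
  · -- onto
    rintro Λ ⟨⟨z, c, hz0, hcfix, hc0, hc1, hΛ⟩, hstab, hself⟩
    obtain ⟨g, hg⟩ := exists_latt_map_eq_of_order jE hρρ hα hα1 hint hjv hjfix φ hφs hφo hz0 hcfix hc0 hc1 hΛ
    refine ⟨latt (g : Matrix (Fin 2) (Fin 2) E), ⟨?_, ?_⟩, hg⟩
    · -- self-dual
      refine isSelfDualLattice_latt_of_dualLatt_eq σ hvσ hϖ0 hϖ1 hH₂ g ?_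
      refine dualLatt_eq_of_forall_herm_iff_mem σ H₂ jE ρ Θ h hjv φ hφi hform ?_
      rw [hg]; exact hself
    · -- fixed
      refine (mapGL_eq_iff_forall_mul_mem jE hρρ hvρ hα hα1 hint hjv hjfix φ hφs hφi hφγ hlam g).2 ?_
      rw [hg]; exact hstab

end Literature.NumberTheory.Automorphic.EllipticPlaneAsFieldLine

end
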